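import Literature.Computability.Cryptography.GoldreichLevinHiding
import HarnessLib

/-!
# The Goldreich–Levin theorem for hiding functions of fixed output length (statement)

The named fact `goldreichLevin_hiding` (`GoldreichLevinHiding.lean`) quantifies over *all*
`g : List Bool → List Bool`. Its proof by reduction runs the distinguisher `D` inside an
inverter, which must supply `D` with exactly `D.coinLen |input|` coins; in the tree's model
(`RandAlg`: `coinLen` an arbitrary function `ℕ → ℕ`) this number is available to a uniform
machine only as *advice* tied to the security parameter `n` (the coin-length trick of
`YaoAmplification.lean` / `LiuPassCondFromRegular.lean`), which requires `D`'s input length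
`|⟨1ⁿ, g(x‖ρ) ‖ σ ‖ u⟩|` to be a function of `n` alone. This file states the theorem under that
proviso — **`g` has a fixed output length `ℓ_g(n)` on the seeds of level `n`**
(`goldreichLevin_hiding_len`) — which is the form proved in the tree
(`GoldreichLevinPredictor.lean` and its sequels) and the form Liu–Pass's Lemma 5.3 uses
(`|f_{r(n)}(x, σ₁, σ₂)| = m(n) + L(n)`). The general fact implies it trivially
(`goldreichLevin_hiding_len_of`).

## References

* O. Goldreich, L. Levin, *A hard-core predicate for all one-way functions*, STOC 1989.
* O. Goldreich, *Foundations of Cryptography I*, CUP 2001, Thm 2.5.6.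
* Y. Liu, R. Pass, *On one-way functions and Kolmogorov complexity*, FOCS 2020
  (arXiv:2009.11514), Appendix, Thm [GL89].
-/

namespace Literature.Computability.Cryptography

open Filter

/-- **Fixed output length on the seeds**: `|g(x ‖ ρ)| = ℓ_g(n)` for `x ∈ S_n`, `|ρ| = m(n)`. [folklore] -/
def HasSeedLength (g : List Bool → List Bool) (S : ∀ n : ℕ, Finset (List.Vector Bool n)) (m ℓg : ℕ → ℕ) : Prop :=
  ∀ (n : ℕ) (x : List.Vector Bool n) (ρ : List Bool), x ∈ S n → ρ.length = m n → (g (x.toList ++ ρ)).length = ℓg n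

/-- **The Goldreich–Levin theorem for hiding functions, `O(log n)` bits, fixed output length**
(the statement of `goldreichLevin_hiding` under the proviso `HasSeedLength g S m ℓg`): if `g` is
`𝒮`-hiding then `{g(x‖ρ) ‖ σ ‖ GL_{d⌊log₂ n⌋}(x, σ)}` and `{g(x‖ρ) ‖ σ ‖ U_{d⌊log₂ n⌋}}` are
computationally indistinguishable. [O. Goldreich, L. Levin, STOC 1989; Goldreich 2001, Thm 2.5.6;
Y. Liu, R. Pass, FOCS 2020, Appendix, Thm [GL89]]
[cite: LiuPassFOCS2020, Appendix (Thm [GL89], hardcore functions for S-hiding f)] -/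
def goldreichLevin_hiding_len : Prop :=
  ∀ (S : ∀ n : ℕ, Finset (List.Vector Bool n)) (g : List Bool → List Bool) (m : ℕ → ℕ) (d : ℕ) (ℓg : ℕ → ℕ),
    HasSeedLength g S m ℓg → (∀ᶠ n in atTop, (S n).Nonempty) → IsHidingOver g S m →
      IsCompIndistinguishable (glRealEns g S m d) (glIdealEns g S m d)

/-- The general fact implies the fixed-length form. [folklore] -/
theorem goldreichLevin_hiding_len_of (h : goldreichLevin_hiding) : goldreichLevin_hiding_len :=
  fun S g m d _ _ hne hhid => h S g m d hne hhid

end Literature.Computability.Cryptography
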